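import Summits.Parity.GeneralizedHardyLittlewood.Theorems.LeeYangFibresRelativeDimOneSplitCosetMean2
import Summits.Parity.GeneralizedHardyLittlewood.Theorems.LeeYangFibresRelativeDimOneSingularTail
import Summits.Parity.GeneralizedHardyLittlewood.Theorems.LeeYangFibresRelativeDimOneSingularMeanGlueAux
import HarnessLib

/-!
# Coset singular means III: uniform tails, the coset factor, and the bookkeeping inequalities
(crux stmt-Parity-14113 `LeeYangFibres.RelativeDimOne`, line gallagher-backwards-split, stub
`stub_cosetSingularMean`, infrastructure file 3 of 4)

Analytic inputs for the coset singular means `CosetSingularMean` (Gallagher 1976 / Goldston–Suriajaya 2021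
averaging of singular series `𝔖(sys a b)` over the shifts `b ≡ c (q)` of a box):

* `abs_singularProduct_sub_prod_le`: UNIFORM TAILS with an enlarged truncation set — for a non-degenerate
  `d = 1` system `Φ` with `‖Φ‖_N ≤ L` and ANY finite set of primes `S' ⊇ {p ≤ y_N}`,
  `|𝔖(Φ) − ∏_{p ∈ S'} β_p(Φ)| ≤ δ ∏_{p ∈ S'} β_p(Φ)` for `N ≥ N₀(T, L, δ)` (the proof of `stub_singularTail`,
  `sum_abs_localFactor_sub_one_le` + `exists_threshold`, with `{p ≤ y}` replaced by `S'`; we use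
  `S' = {p ∣ q} ∪ {p ≤ y, p ∤ q}`);
* `affLinSize_sys_le`, `prod_localFactor_le_pow` (`∏_{p ∈ S} β_p ≤ y^T` for `S ⊆ {p ≤ y}`);
* the coset factor: `prod_primeFactors_div_eq` (Euler, `∏_{p∣q} p/(p−1) = q/φ(q)`), `localTypeFactor_le`
  (registered auxiliary theorem `localTypeFactor_le_totient`: `∏_{p ∣ q} β_p(a,c) ≤ (q/φ(q))^t`),
  `prod_primeFactors_localFactor_eq` (along `b ≡ c (q)` the factors at `p ∣ q` are frozen);
* `primorial_mul_pow_truncLevel_eventually_le_sqrt`: `(∏_{p ≤ y_N} p) y_N^T ≤ η √N` eventually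
  (`∏_{p ≤ y_N} p ≤ N^{(log 4)/4}` and `(log 4)/4 < 0.35`);
* elementary inequalities for the assembly (`assembly_abs_le`, `one_sub_div_mul_prod_le`, `block_volume_le`,
  `floor_div_ge`).

References: P. X. Gallagher, Mathematika 23 (1976), §2 [Gallagher1976]; B. Green, T. Tao, Ann. of Math. 171
(2010), Lemma 1.3 [GreenTao2010].
-/

noncomputable section

open scoped BigOperators Classical Topology
open Finset Filter Literature.NumberTheory.Sieve

namespace Summit.Parity.GeneralizedHardyLittlewood.Cruxes.RelativeDimOne.GallagherBackwardsSplit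

namespace CosetMeanProof

open TranslateAmplification (truncLevel truncLevel_le_log_div primorial_truncLevel_le_rpow)
open TranslateAmplification.SingularTailProof (sum_abs_localFactor_sub_one_le)

variable {t : ℕ}

/-! ### Uniform tails of the singular product with an enlarged truncation set -/

/-- UNIFORM TAILS (Green–Tao Lemma 1.3 with Gallagher's bookkeeping, as in `stub_singularTail`): for a
non-degenerate one-dimensional system `Φ` with `‖Φ‖_N ≤ L`, `y ≥ max(2, L, 2T)` with the tail bound
`σ(T, L, N, y) ≤ δ/2` of `sum_abs_localFactor_sub_one_le`, and ANY finite set of primes `S' ⊇ {p ≤ y}`: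
`|𝔖(Φ) − ∏_{p ∈ S'} β_p| ≤ δ ∏_{p ∈ S'} β_p` (for `x ≥ max(y, max S')`,
`|∏_{p ≤ x, p ∉ S'} β_p − 1| ≤ exp(∑_{y < p ≤ x} |β_p − 1|) − 1 ≤ δ`, then `x → ∞`). -/
theorem abs_singularProduct_sub_prod_le {T : ℕ} (Φ : Fin T → AffLinForm 1) (hΦ : IsNondegenerateSystem Φ)
    {N L y : ℕ} (hN : 0 < N) (hL : affLinSize Φ N ≤ L) (hy2 : 2 ≤ y) (hyL : L ≤ y) (hyT : 2 * T ≤ y)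
    {δ : ℝ} (hδ0 : 0 < δ) (hδ1 : δ ≤ 1)
    (hσ : (T : ℝ) ^ 2 / y + 4 * T / y * ((T : ℝ) ^ 2 *
      (Real.log ((2 * L ^ 2 * N : ℕ) : ℝ) / Real.log y)) ≤ δ / 2)
    (S' : Finset ℕ) (hS' : ∀ p ∈ S', p.Prime) (hyS : Nat.primesLE y ⊆ S') :
    |singularProduct Φ - ∏ p ∈ S', localFactor Φ p| ≤ δ * ∏ p ∈ S', localFactor Φ p := by
  have hF0 : 0 ≤ ∏ p ∈ S', localFactor Φ p := Finset.prod_nonneg fun p _ => localFactor_nonneg Φ p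
  set x₀ := max y (S'.sup id) with hx₀
  have hsub : ∀ x, x₀ ≤ x → S' ⊆ Nat.primesLE x := by
    intro x hx p hp
    rw [Nat.mem_primesLE]
    exact ⟨le_trans (le_trans (Finset.le_sup (f := id) hp) (le_max_right _ _)) hx, hS' p hp⟩
  have htail : ∀ x : ℕ, x₀ ≤ x →
      |singularProductPartial Φ x - ∏ p ∈ S', localFactor Φ p| ≤ δ * ∏ p ∈ S', localFactor Φ p := by
    intro x hx
    set Q := ∏ p ∈ Nat.primesLE x \ S', localFactor Φ p with hQ
    have hsplit : singularProductPartial Φ x = (∏ p ∈ S', localFactor Φ p) * Q := by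
      unfold singularProductPartial
      rw [hQ, mul_comm, Finset.prod_sdiff (hsub x hx)]
    have hs : ∑ p ∈ Nat.primesLE x \ S', |localFactor Φ p - 1| ≤ δ / 2 :=
      calc ∑ p ∈ Nat.primesLE x \ S', |localFactor Φ p - 1|
          ≤ ∑ p ∈ Nat.primesLE x \ Nat.primesLE y, |localFactor Φ p - 1| :=
            Finset.sum_le_sum_of_subset_of_nonneg
              (Finset.sdiff_subset_sdiff (Finset.Subset.refl _) hyS) (fun p _ _ => abs_nonneg _)
        _ ≤ _ := (sum_abs_localFactor_sub_one_le Φ hΦ hN hL hy2 hyL hyT x).trans hσ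
    have h1 : |Q - 1| ≤ Real.exp (∑ p ∈ Nat.primesLE x \ S', |localFactor Φ p - 1|) - 1 := by
      have := Finset.norm_prod_one_add_sub_one_le (Nat.primesLE x \ S') (fun p => localFactor Φ p - 1)
      simp only [add_sub_cancel, Real.norm_eq_abs] at this
      rw [hQ]
      exact this
    have h2 := Real.exp_le_exp.mpr hs
    have hδ2 : (0 : ℝ) ≤ δ / 2 := by positivity
    have h3 : Real.exp (δ / 2) - 1 ≤ 2 * (δ / 2) := by
      have := Real.abs_exp_sub_one_le (x := δ / 2) (by rw [abs_of_nonneg hδ2]; linarith)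
      rw [abs_of_nonneg hδ2] at this
      exact (le_abs_self _).trans this
    have hQ1 : |Q - 1| ≤ δ := by linarith
    calc |singularProductPartial Φ x - ∏ p ∈ S', localFactor Φ p|
        = |∏ p ∈ S', localFactor Φ p| * |Q - 1| := by
          rw [hsplit, ← abs_mul]
          ring_nf
      _ ≤ (∏ p ∈ S', localFactor Φ p) * δ := by
          rw [abs_of_nonneg hF0]
          exact mul_le_mul_of_nonneg_left hQ1 hF0
      _ = δ * ∏ p ∈ S', localFactor Φ p := mul_comm _ _
  have hlim : Tendsto (fun x => |singularProductPartial Φ x - ∏ p ∈ S', localFactor Φ p|) atTop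
      (𝓝 |singularProduct Φ - ∏ p ∈ S', localFactor Φ p|) :=
    (continuous_abs.tendsto _).comp
      ((tendsto_singularProductPartial_holds 1 T Φ hΦ).sub tendsto_const_nhds)
  exact le_of_tendsto hlim (Filter.eventually_atTop.mpr ⟨x₀, htail⟩)

/-- The size of `sys a b` at scale `N`: `‖sys a b‖_N ≤ L (t+1)` when `∑ |a_i| ≤ L` and `|b_i| ≤ L N`. -/
theorem affLinSize_sys_le {a b : Fin t → ℤ} {N L : ℕ} (hN : 0 < N) (ha : ∑ i, |a i| ≤ (L : ℤ))
    (hb : ∀ i, |(b i : ℝ)| ≤ L * N) : affLinSize (sys a b) N ≤ ((L * (t + 1) : ℕ) : ℝ) := by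
  have hN0 : (0 : ℝ) < N := by exact_mod_cast hN
  have h1 : ∑ i, ∑ j : Fin 1, |((sys a b i).coeff j : ℝ)| = ∑ i, |(a i : ℝ)| := by
    refine Finset.sum_congr rfl fun i _ => ?_
    rw [Fin.sum_univ_one]
    rfl
  have h2 : ∑ i, |(a i : ℝ)| ≤ L := by
    have : ((∑ i, |a i| : ℤ) : ℝ) ≤ ((L : ℤ) : ℝ) := by exact_mod_cast ha
    push_cast at this
    exact this
  have h3 : ∑ i, |((sys a b i).const : ℝ) / N| ≤ t * L :=
    calc ∑ i, |((sys a b i).const : ℝ) / N| = ∑ i, |(b i : ℝ)| / N := by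
          refine Finset.sum_congr rfl fun i _ => ?_
          rw [abs_div, abs_of_pos hN0]
          rfl
      _ ≤ ∑ _i : Fin t, (L : ℝ) := Finset.sum_le_sum fun i _ => by
          rw [div_le_iff₀ hN0]
          exact hb i
      _ = t * L := by simp
  unfold affLinSize
  rw [h1]
  push_cast
  nlinarith

/-- `∏_{p ∈ S} β_p(Φ) ≤ y^T` for `S ⊆ {p ≤ y}` (`β_p ≤ (p/(p-1))^T` and `∏_{p ≤ y} (1 - 1/p)⁻¹ ≤ y`). -/
theorem prod_localFactor_le_pow {T : ℕ} (Φ : Fin T → AffLinForm 1) {y : ℕ} (hy : 1 ≤ y) (S : Finset ℕ)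
    (hS : S ⊆ Nat.primesLE y) : ∏ p ∈ S, localFactor Φ p ≤ (y : ℝ) ^ T := by
  have hfac : ∀ p ∈ Nat.primesLE y, 1 ≤ (1 - 1 / (p : ℝ))⁻¹ := fun p hp => by
    have hp' := (Nat.mem_primesLE.1 hp).2
    have hp2 : (2 : ℝ) ≤ p := by exact_mod_cast hp'.two_le
    rw [one_le_inv_iff₀]
    constructor
    · rw [sub_pos, div_lt_one (by linarith)]
      linarith
    · rw [sub_le_self_iff]
      positivity
  calc ∏ p ∈ S, localFactor Φ p
      ≤ ∏ p ∈ S, (1 - 1 / (p : ℝ))⁻¹ ^ T := by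
        refine Finset.prod_le_prod (fun p _ => localFactor_nonneg Φ p) fun p hp => ?_
        have hp' := (Nat.mem_primesLE.1 (hS hp)).2
        have hp0 : (0 : ℝ) < p := by exact_mod_cast hp'.pos
        rw [one_sub_div hp0.ne', inv_div]
        exact localFactor_prime_le Φ hp'
    _ ≤ ∏ p ∈ Nat.primesLE y, (1 - 1 / (p : ℝ))⁻¹ ^ T :=
        Finset.prod_le_prod_of_subset_of_one_le hS
          (fun p hp => pow_nonneg (zero_le_one.trans (hfac p (hS hp))) T)
          fun p hp _ => one_le_pow₀ (hfac p hp)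
    _ = (∏ p ∈ Nat.primesLE y, (1 - 1 / (p : ℝ))⁻¹) ^ T := Finset.prod_pow _ _ _
    _ ≤ (y : ℝ) ^ T :=
        pow_le_pow_left₀ (Finset.prod_nonneg fun p hp => zero_le_one.trans (hfac p hp))
          (Gallagher.prod_primesLE_inv_le y hy) T

/-! ### The coset factor `∏_{p ∣ q} β_p(a, c)` -/

/-- Euler: `∏_{p ∣ q} p/(p-1) = q/φ(q)` for `q ≥ 1`. -/
theorem prod_primeFactors_div_eq {q : ℕ} (hq : 0 < q) :
    ∏ p ∈ q.primeFactors, ((p : ℝ) / (p - 1)) = (q : ℝ) / Nat.totient q := by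
  have hφ : (0 : ℝ) < Nat.totient q := by exact_mod_cast Nat.totient_pos.2 hq
  have hden : ∀ p ∈ q.primeFactors, (0 : ℝ) < (p : ℝ) - 1 := fun p hp => by
    have : (1 : ℝ) < p := by exact_mod_cast (Nat.prime_of_mem_primeFactors hp).one_lt
    linarith
  have h := Nat.totient_mul_prod_primeFactors q
  have h1 : ((Nat.totient q * ∏ p ∈ q.primeFactors, p : ℕ) : ℝ) =
      ((q * ∏ p ∈ q.primeFactors, (p - 1) : ℕ) : ℝ) := by exact_mod_cast h
  have h2 : ((∏ p ∈ q.primeFactors, (p - 1) : ℕ) : ℝ) = ∏ p ∈ q.primeFactors, ((p : ℝ) - 1) := by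
    rw [Nat.cast_prod]
    exact Finset.prod_congr rfl fun p hp => Nat.cast_pred (Nat.pos_of_mem_primeFactors hp)
  rw [Nat.cast_mul, Nat.cast_mul, Nat.cast_prod, h2] at h1
  rw [Finset.prod_div_distrib, div_eq_div_iff (Finset.prod_pos hden).ne' hφ.ne']
  linarith

/-- `0 ≤ localTypeFactor q a c`. -/
theorem localTypeFactor_nonneg (q : ℕ) (a c : Fin t → ℤ) : 0 ≤ localTypeFactor q a c :=
  Finset.prod_nonneg fun _ _ => localFactor_nonneg _ _

/-- `localTypeFactor q a c = ∏_{p ∣ q} β_p(a, c) ≤ (q/φ(q))^t` (`β_p ≤ (p/(p-1))^t`, Euler's product). -/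
theorem localTypeFactor_le {q : ℕ} (hq : 0 < q) (a c : Fin t → ℤ) :
    localTypeFactor q a c ≤ ((q : ℝ) / Nat.totient q) ^ t := by
  unfold localTypeFactor
  calc ∏ p ∈ q.primeFactors, localFactor (sys a c) p
      ≤ ∏ p ∈ q.primeFactors, ((p : ℝ) / (p - 1)) ^ t :=
        Finset.prod_le_prod (fun _ _ => localFactor_nonneg _ _) fun p hp =>
          localFactor_prime_le _ (Nat.prime_of_mem_primeFactors hp)
    _ = ((q : ℝ) / Nat.totient q) ^ t := by rw [Finset.prod_pow, prod_primeFactors_div_eq hq]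

/-- FROZEN FACTORS: along the coset `b ≡ c (q)` the local factors at `p ∣ q` are those of `(a, c)`:
`∏_{p ∣ q} β_p(sys a b) = localTypeFactor q a c`. -/
theorem prod_primeFactors_localFactor_eq {q : ℕ} (a : Fin t → ℤ) {b c : Fin t → ℤ}
    (h : ∀ l, b l ≡ c l [ZMOD q]) :
    ∏ p ∈ q.primeFactors, localFactor (sys a b) p = localTypeFactor q a c :=
  Finset.prod_congr rfl fun _ hp => localFactor_sys_congr a fun l =>
    (h l).of_dvd (Int.natCast_dvd_natCast.2 (Nat.dvd_of_mem_primeFactors hp))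

/-! ### The size of the truncation: `(∏_{p ≤ y_N} p) · y_N^T = o(√N)` -/

/-- `(∏_{p ≤ y_N} p) · y_N^T ≤ η √N` for all large `N` (`∏_{p ≤ y_N} p ≤ N^{(log 4)/4}`,
`(log 4)/4 < 0.35 < 1/2` by `Real.log_two_lt_d9`, and `log^T N = o(N^{0.15})`). -/
theorem primorial_mul_pow_truncLevel_eventually_le_sqrt (T : ℕ) {η : ℝ} (hη : 0 < η) :
    ∀ᶠ N : ℕ in atTop,
      ((primorial (truncLevel N) : ℕ) : ℝ) * (truncLevel N : ℝ) ^ T ≤ η * (N : ℝ) ^ (1 / 2 : ℝ) := by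
  set a : ℝ := Real.log 4 / 4 with ha
  have ha1 : a < 7 / 20 := by
    have h4 : Real.log 4 = 2 * Real.log 2 := by
      rw [show (4 : ℝ) = 2 ^ 2 by norm_num, Real.log_pow]
      norm_num
    have := Real.log_two_lt_d9
    rw [ha, h4]
    linarith
  have h := (isLittleO_log_rpow_rpow_atTop (T : ℝ) (by linarith : (0 : ℝ) < 1 / 2 - a)).bound hη
  filter_upwards [tendsto_natCast_atTop_atTop.eventually h, eventually_ge_atTop 1] with N hN hN1
  have hN0 : (0 : ℝ) < N := by exact_mod_cast hN1
  have hlog0 : 0 ≤ Real.log N := Real.log_nonneg (by exact_mod_cast hN1)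
  rw [Real.norm_of_nonneg (Real.rpow_nonneg hlog0 _),
    Real.norm_of_nonneg (Real.rpow_nonneg hN0.le _), Real.rpow_natCast] at hN
  have hy : (truncLevel N : ℝ) ^ T ≤ Real.log N ^ T := by
    refine pow_le_pow_left₀ (Nat.cast_nonneg _) ?_ T
    have := truncLevel_le_log_div N hN1
    linarith
  have hP := primorial_truncLevel_le_rpow hN1
  calc ((primorial (truncLevel N) : ℕ) : ℝ) * (truncLevel N : ℝ) ^ T
      ≤ (N : ℝ) ^ a * (η * (N : ℝ) ^ (1 / 2 - a)) :=
        mul_le_mul hP (hy.trans hN) (by positivity) (by positivity)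
    _ = η * (N : ℝ) ^ (1 / 2 : ℝ) := by
        rw [mul_left_comm, ← Real.rpow_add hN0, show a + (1 / 2 - a) = 1 / 2 by ring]

/-! ### Elementary inequalities for the assembly -/

/-- Bookkeeping of the three error terms: with `S = E₁ + LTF · (SF − SD)` (tail error `E₁`, coset sum `SF`
of the coprime local products, its degenerate part `SD`), `|E₁| ≤ δ' LTF (SF − SD)`, the sandwich
`V₀ ≤ SF, Pc ≤ V₁` and `0 ≤ SD ≤ M_b D_n`:  `|S − LTF Pc| ≤ LTF (δ' V₁ + (V₁ − V₀) + M_b D_n)`. -/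
theorem assembly_abs_le {S E₁ LTF SF SD Pc V₀ V₁ Mb Dn δ' : ℝ} (hLTF : 0 ≤ LTF) (hδ' : 0 ≤ δ')
    (hS : S = E₁ + LTF * (SF - SD)) (hE : |E₁| ≤ δ' * (LTF * (SF - SD)))
    (hSF1 : SF ≤ V₁) (hSF0 : V₀ ≤ SF) (hPc0 : V₀ ≤ Pc) (hPc1 : Pc ≤ V₁) (hSD0 : 0 ≤ SD)
    (hSD1 : SD ≤ Mb * Dn) :
    |S - LTF * Pc| ≤ LTF * (δ' * V₁ + (V₁ - V₀) + Mb * Dn) := by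
  have h1 : |E₁| ≤ LTF * (δ' * V₁) := by
    refine hE.trans ?_
    have : SF - SD ≤ V₁ := by linarith
    have := mul_le_mul_of_nonneg_left this (mul_nonneg hLTF hδ')
    nlinarith
  have h2 : |SF - SD - Pc| ≤ (V₁ - V₀) + Mb * Dn := by
    rw [abs_le]
    constructor <;> linarith
  have h3 : |LTF * (SF - SD - Pc)| ≤ LTF * ((V₁ - V₀) + Mb * Dn) := by
    rw [abs_mul, abs_of_nonneg hLTF]
    exact mul_le_mul_of_nonneg_left h2 hLTF
  calc |S - LTF * Pc| = |E₁ + LTF * (SF - SD - Pc)| := by rw [hS]; ring_nf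
    _ ≤ |E₁| + |LTF * (SF - SD - Pc)| := abs_add_le _ _
    _ ≤ LTF * (δ' * V₁) + LTF * ((V₁ - V₀) + Mb * Dn) := add_le_add h1 h3
    _ = LTF * (δ' * V₁ + (V₁ - V₀) + Mb * Dn) := by ring

/-- The two block volumes are close: if `K ≤ m_l + 1` for all `l` (`K ≥ 1`) then
`(1 − t/K) ∏_l (m_l + 1) ≤ ∏_l m_l` (`m_l/(m_l+1) ≥ 1 − 1/K` and Bernoulli). -/
theorem one_sub_div_mul_prod_le {K : ℝ} (hK : 1 ≤ K) (m : Fin t → ℕ) (hm : ∀ l, K ≤ (m l : ℝ) + 1) :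
    (1 - t / K) * ∏ l, ((m l : ℝ) + 1) ≤ ∏ l, (m l : ℝ) := by
  have hK0 : 0 < K := by linarith
  have hB : 1 - t / K ≤ (1 - 1 / K) ^ t := by
    have hK2 : 1 / K ≤ 1 := (div_le_one hK0).2 hK
    have := one_add_mul_le_pow (a := -(1 / K)) (by linarith) t
    calc 1 - (t : ℝ) / K = 1 + t * -(1 / K) := by ring
      _ ≤ (1 + -(1 / K)) ^ t := this
      _ = (1 - 1 / K) ^ t := by ring
  have hfac : ∀ l, (1 - 1 / K) * ((m l : ℝ) + 1) ≤ m l := by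
    intro l
    have h1 : 0 < (m l : ℝ) + 1 := by positivity
    have : 1 / ((m l : ℝ) + 1) ≤ 1 / K := one_div_le_one_div_of_le hK0 (hm l)
    calc (1 - 1 / K) * ((m l : ℝ) + 1) ≤ (1 - 1 / ((m l : ℝ) + 1)) * ((m l : ℝ) + 1) :=
          mul_le_mul_of_nonneg_right (by linarith) h1.le
      _ = m l := by field_simp; ring
  have hK1 : 0 ≤ 1 - 1 / K := by
    rw [sub_nonneg, div_le_one hK0]
    exact hK
  calc (1 - t / K) * ∏ l, ((m l : ℝ) + 1)
      ≤ (1 - 1 / K) ^ t * ∏ l, ((m l : ℝ) + 1) :=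
        mul_le_mul_of_nonneg_right hB (Finset.prod_nonneg fun l _ => by positivity)
    _ = ∏ l, ((1 - 1 / K) * ((m l : ℝ) + 1)) := by
        rw [Finset.prod_mul_distrib, Finset.prod_const, Finset.card_univ, Fintype.card_fin]
    _ ≤ ∏ l, (m l : ℝ) := Finset.prod_le_prod (fun l _ => mul_nonneg hK1 (by positivity)) fun l _ => hfac l

/-- The outer block volume is at most `2^t ∏_l (X_l + 1)/q` once `P q ≤ X_l + 1`
(`(⌊(X_l+1)/(Pq)⌋ + 1) P ≤ (X_l+1)/q + P ≤ 2 (X_l+1)/q`). -/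
theorem block_volume_le {q P : ℕ} (hq : 0 < q) (hP : 0 < P) (X : Fin t → ℕ)
    (hPq : ∀ l, P * q ≤ X l + 1) :
    (∏ l, ((((X l + 1) / (P * q) : ℕ) : ℝ) + 1)) * (P : ℝ) ^ t ≤
      2 ^ t * ∏ l, (((X l : ℝ) + 1) / q) := by
  have hq0 : (0 : ℝ) < q := by exact_mod_cast hq
  have hP0 : (0 : ℝ) < P := by exact_mod_cast hP
  have hL : (∏ l, ((((X l + 1) / (P * q) : ℕ) : ℝ) + 1)) * (P : ℝ) ^ t =
      ∏ l, (((((X l + 1) / (P * q) : ℕ) : ℝ) + 1) * P) := by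
    rw [Finset.prod_mul_distrib, Finset.prod_const, Finset.card_univ, Fintype.card_fin]
  have hR : (2 : ℝ) ^ t * ∏ l, (((X l : ℝ) + 1) / q) = ∏ l, (2 * (((X l : ℝ) + 1) / q)) := by
    rw [Finset.prod_mul_distrib, Finset.prod_const, Finset.card_univ, Fintype.card_fin]
  rw [hL, hR]
  refine Finset.prod_le_prod (fun l _ => by positivity) fun l _ => ?_
  have h1 : ((((X l + 1) / (P * q) : ℕ) : ℝ)) ≤ ((X l : ℝ) + 1) / (P * q) := by
    have := Nat.cast_div_le (α := ℝ) (m := X l + 1) (n := P * q)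
    push_cast at this
    exact this
  have h2 : (P : ℝ) * q ≤ (X l : ℝ) + 1 := by exact_mod_cast hPq l
  have h3 : (P : ℝ) ≤ ((X l : ℝ) + 1) / q := by rw [le_div_iff₀ hq0]; exact h2
  calc (((((X l + 1) / (P * q) : ℕ) : ℝ)) + 1) * P ≤ (((X l : ℝ) + 1) / (P * q) + 1) * P := by
        gcongr
    _ = ((X l : ℝ) + 1) / q + P := by field_simp
    _ ≤ 2 * (((X l : ℝ) + 1) / q) := by linarith

/-- The coordinate count `n₀ = ⌊δ N⌋ / q` is large: `n₀ ≥ δ √N / 2` once `q ≤ √N` and `√N ≥ 2/δ`. -/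
theorem floor_div_ge {δ R : ℝ} {q N : ℕ} (hδ : 0 < δ) (hq : 0 < q) (hqR : (q : ℝ) ≤ R)
    (hRR : R * R = N) (hR : 2 / δ ≤ R) : δ * R / 2 ≤ ((⌊δ * N⌋₊ / q : ℕ) : ℝ) := by
  have hq0 : (0 : ℝ) < q := by exact_mod_cast hq
  have hR0 : 0 < R := lt_of_lt_of_le (by positivity) hR
  have hδR : 2 ≤ δ * R := by rwa [div_le_iff₀ hδ, mul_comm] at hR
  set n₀ := ⌊δ * N⌋₊ / q with hn₀
  have h1 : n₀ * q + ⌊δ * N⌋₊ % q = ⌊δ * N⌋₊ := Nat.div_add_mod' _ _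
  have h2 : ⌊δ * N⌋₊ % q + 1 ≤ q := Nat.mod_lt _ hq
  have h3 : δ * N - 1 < ⌊δ * N⌋₊ := Nat.sub_one_lt_floor _
  have h4 : δ * N - q ≤ (n₀ : ℝ) * q := by
    have e1 : ((n₀ * q + ⌊δ * N⌋₊ % q : ℕ) : ℝ) = ⌊δ * N⌋₊ := by exact_mod_cast h1
    have e2 : ((⌊δ * N⌋₊ % q + 1 : ℕ) : ℝ) ≤ q := by exact_mod_cast h2
    push_cast at e1 e2
    linarith
  rw [← hRR] at h4
  -- `δ R q / 2 ≤ δ R² − q ≤ n₀ q`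
  have h5 : δ * R / 2 * q ≤ (n₀ : ℝ) * q := by nlinarith
  exact le_of_mul_le_mul_right h5 hq0

end CosetMeanProof

open CosetMeanProof in
/-- **Registered auxiliary theorem** (infrastructure for `stub_cosetSingularMean`): the coset factor is at most
`(q/φ(q))^t` — `localTypeFactor q a c = ∏_{p ∣ q} β_p(a, c) ≤ ∏_{p ∣ q} (p/(p−1))^t = (q/φ(q))^t`
(`β_p ≤ (p/(p−1))^t`, Euler's product formula). -/
theorem localTypeFactor_le_totient : ∀ {t q : ℕ}, 0 < q → ∀ (a c : Fin t → ℤ), localTypeFactor q a c ≤ ((q : ℝ) / Nat.totient q) ^ t :=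
  fun hq a c => localTypeFactor_le hq a c

end Summit.Parity.GeneralizedHardyLittlewood.Cruxes.RelativeDimOne.GallagherBackwardsSplit

end
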